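import Summits.HodgeConjecture.HodgeConjecture.Theorems.HeckePrymWeilAimedDescendingOfAimedSplitProduct
import Summits.HodgeConjecture.HodgeConjecture.Theorems.HeckePrymWeilAimedDescendingProductFrame
import Summits.HodgeConjecture.HodgeConjecture.Theorems.HeckePrymWeilAimedDescendingProductModel
import Summits.HodgeConjecture.HodgeConjecture.Theorems.HeckePrymWeilAimedDescendingWeilTypeModel
import Summits.HodgeConjecture.HodgeConjecture.Theorems.HeckePrymWeilAimedDescendingRationalModel
import Summits.HodgeConjecture.HodgeConjecture.Theorems.NikulinTwinTransportAlgebraicClassesOneOneK3Proof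
import Literature.AlgebraicGeometry.Motives.AimedSplitProductProofs
import Literature.AlgebraicGeometry.Motives.AbelianVarietyCohomologyExteriorH1
import HarnessLib

/-!
# Crux `WeilSixfoldsSqrtMinus7` (stmt-HodgeConjecture-1260), line `hyperbolic-eightfold-descent` — sub-goal G2b: the descent pair on the CM Weil surface `(E × E, (ι, -ι))`

Route `HeckePrymWeil`, Stub 7 of the line (the AIMED partner at `d = 7`). The partner is van Geemen's
CM Weil surface `B = E₀ × E₀`, `ψ = (ι, -ι) = prodLift (fst ≫ ι) (snd ≫ (-ι))`, `ι ≫ ι = -7` (the curve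
is built by another seat), and Schoen's transfer `Theorems.productDescentAt_of_descentPair` needs a
DESCENT PAIR on `(B, ψ)`. Proved here, with `(E, ι)` and a rational basis `(α, β)` of `H¹(E(ℂ); ℂ)` as
hypotheses:

* `stub_cmDescentPair` — **`B = E × E`, `ψ = (fst ≫ ι, snd ≫ (-ι))` carries `b₊ ∈ Eig((𝟙+ψ)^*, (1+i√7)²)`,
  `b₋ ∈ Eig((𝟙+ψ)^*, (1-i√7)²)` in `H²(B(ℂ); ℂ)` with `b₊ + b₋` rational of Hodge type `(1,1)`, and an
  ALGEBRAIC `η ∈ N¹H²(B(ℂ); ℂ)` with `b₊ ⌣ η ≠ 0`, `b₋ ⌣ η ≠ 0` in `H⁴(B(ℂ); ℂ)`** — the seven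
  clauses of the descent-pair typing of `Literature/AlgebraicGeometry/Motives/AimedSplitProduct`.

This is the cohomological content of Schoen's partner surface (Compositio Math. 114 (1998), §10,
p. 333: "`W_{A'}` has Hodge type `(1,1)`", "`W_{A'}` is generated by cohomology classes of divisors",
the products of the two Weil lines with a divisor class do not vanish) on van Geemen's CM example
(LNM 1594, 5.3: `√-d` acting on `E₀ × E₀` through `(x, y) ↦ (√-d x, -√-d y)`).

## Proof (witnesses)

`F = fst^*`, `S = snd^*`, `J = ι^*`, `ν = i√7`, `ω = α ∪ β`. Pull-back on `H¹` is additive in the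
homomorphism, so `J² = -7`; with `Jα = aα + bβ`, `Jβ = cα + dβ`: `a² + bc = -7`, `b(a + d) = 0`, and `a`
is RATIONAL (`repr_mem_range_ratCast_of_isRationalClass`), so `b ≠ 0` and `d = -a`.
* `x_± = Jα ± να` are `J`-eigenclasses (`±ν`); `b₊ = F x₊ ∪ S x₋`, `b₋ = F x₋ ∪ S x₊` are
  `(𝟙+ψ)^*`-eigenclasses for `(1 ± ν)²` (`map_one_add_cupProduct_fst_snd`, `ψ` lies over `ι`, `-ι`).
* `b₊ + b₋ = 2 FJα ∪ SJα + 14 Fα ∪ Sα` is rational and equals `-2b · D`,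
  `D = (fst + snd ≫ ι)^*ω - Fω - 7 Sω` (expand in the frame `Fu ∪ Sv`). `D` is ALGEBRAIC: `ω ∈ N¹H²(E)`
  (top degree, `mem_algebraicClasses_of_degree_top`) and `fst`, `snd`, `fst + snd ≫ ι` are FLAT (the
  last is the automorphism `(fst + snd ≫ ι, snd)` of `E × E` followed by `fst`), so pull-back preserves
  `N¹` (`map_mem_algebraicClasses_of_flat`); hence `b₊ + b₋` is of type `(1,1)`
  (`Theorems.isOfHodgeType_oneOne_of_mem_algebraicClasses_surface`).
* `η = b₊ + b₋`. From `(Fu ∪ Sv) ∪ (Fu' ∪ Sv') = -(F(u∪u') ∪ S(v∪v'))` and `x ∪ x = 0` in degree one: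
  `b_± ∪ b_± = 0`, `b₊ ∪ b₋ = b₋ ∪ b₊ = (2νb)² Fω ∪ Sω ≠ 0` (Künneth, `cupProduct_map_fst_map_snd_ne_zero`).

Design note. In the main proof the pull-backs `fst^*`, `snd^*`, `ι^*`, `(fst + snd ≫ ι)^*` are OPAQUE
local symbols with defining equations, each needed property transported once; the frame algebra
(`module`, `match_scalars`) then never attempts a definitional comparison of two distinct scheme
morphisms (which does not terminate in practice on fibre products). Everything is proved; no
definition, no named fact. Relies on: nothing unproved.

References: [Schoen1998HodgeWeilAddendum] C. Schoen, Compositio Math. 114 (1998), §10 (p. 333);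
[vanGeemen1994HodgeAV] B. van Geemen, LNM 1594 (1994), 5.3, Lemma 5.2 (6); [LangeBirkenhake1992]
1.1.2, Lemma 1.1.17; [Hartshorne1977] III Prop. 9.2; [HatcherAT2002] §3.2 Prop. 3.10, Thm. 3.11, 3.16.
-/

noncomputable section

-- single-problem summit (Problem = Summit): the mandated namespace repeats `HodgeConjecture`.
set_option linter.dupNamespace false

open CategoryTheory Literature.AlgebraicGeometry Literature.AlgebraicGeometry.Motives
  Literature.AlgebraicGeometry.HodgeTheory Literature.AlgebraicTopology.SingularHomology
  Literature.Geometry.Kaehler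

namespace Summit.HodgeConjecture.HodgeConjecture.Theorems.WeilSixfoldsSqrtMinus7.HyperbolicEightfoldDescent

/-! ## Tools: pull-back on `H¹`, flatness of the sheared projection, products of cross products -/

/-- `𝟙^* = id` on `Hᵏ(A(ℂ); ℂ)`. [folklore] -/
private theorem map_id_hom_apply (A : AbelianVariety ℂ) {k : ℕ} (v : complexBetti A.X k) :
    complexBetti.map (𝟙 A : A ⟶ A).hom.hom.hom k v = v := by
  change complexBetti.map (𝟙 A.X) k v = v
  rw [complexBetti.map_id]
  rfl

/-- `(𝟙 + g)^* x = (1 + μ) x` for a `g^*`-eigenclass `x ∈ H¹(A(ℂ); ℂ)` (additivity of pull-back on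
`H¹`). [cite: LangeBirkenhake1992, 1.1.2 and Lemma 1.1.17 (a)] -/
private theorem map_one_add_of_eigen {A : AbelianVariety ℂ} (g : A ⟶ A) {x : complexBetti A.X 1}
    {μ : ℂ} (hx : complexBetti.map g.hom.hom.hom 1 x = μ • x) :
    complexBetti.map (𝟙 A + g).hom.hom.hom 1 x = (1 + μ) • x := by
  rw [complexBetti_map_add_deg_one, map_id_hom_apply, hx, add_smul, one_smul]

/-- `(𝟙 - g)^* x = (1 - μ) x` for a `g^*`-eigenclass `x ∈ H¹(A(ℂ); ℂ)`.
[cite: LangeBirkenhake1992, 1.1.2 and Lemma 1.1.17 (a)] -/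
private theorem map_one_add_neg_of_eigen {A : AbelianVariety ℂ} (g : A ⟶ A) {x : complexBetti A.X 1}
    {μ : ℂ} (hx : complexBetti.map g.hom.hom.hom 1 x = μ • x) :
    complexBetti.map (𝟙 A + (-g)).hom.hom.hom 1 x = (1 - μ) • x := by
  rw [complexBetti_map_add_deg_one, map_id_hom_apply, complexBetti_map_neg_deg_one, hx, sub_smul,
    one_smul, sub_eq_add_neg]

/-- `ι^* ι^* = -7` on `H¹(E(ℂ); ℂ)` for `ι ≫ ι = -7`. [cite: LangeBirkenhake1992, 1.1.2 and Lemma 1.1.17 (a)] -/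
private theorem map_map_eq_neg_seven_smul {E : AbelianVariety ℂ} {ι : E ⟶ E}
    (hι : ι ≫ ι = -((7 : ℤ) • 𝟙 E)) (v : complexBetti E.X 1) :
    complexBetti.map ι.hom.hom.hom 1 (complexBetti.map ι.hom.hom.hom 1 v) = -(7 : ℂ) • v := by
  rw [complexBetti_map_map_hom, hι, complexBetti_map_neg_deg_one, ofNat_zsmul,
    complexBetti_map_nsmul_deg_one, map_id_hom_apply, ← Nat.cast_smul_eq_nsmul ℂ, neg_smul]
  norm_num

/-- **The sheared projection `fst + snd ≫ g : A × B → A` is flat**: it is the automorphism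
`(fst + snd ≫ g, snd)` of `A × B` (inverse `(fst - snd ≫ g, snd)`) followed by the flat projection
`fst`. [cite: Hartshorne1977, III Prop. 9.2] -/
private theorem flat_fst_add_snd_comp {A B : AbelianVariety ℂ} (g : B ⟶ A) :
    AlgebraicGeometry.Flat (AbelianVariety.fst A B + AbelianVariety.snd A B ≫ g).hom.hom.hom.left := by
  set σ : A.prod B ⟶ A.prod B :=
    AbelianVariety.prodLift (AbelianVariety.fst A B + AbelianVariety.snd A B ≫ g) (AbelianVariety.snd A B)
  set τ : A.prod B ⟶ A.prod B :=
    AbelianVariety.prodLift (AbelianVariety.fst A B - AbelianVariety.snd A B ≫ g) (AbelianVariety.snd A B)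
  have hστ : σ ≫ τ = 𝟙 (A.prod B) := by
    apply AbelianVariety.prod_hom_ext
    · rw [Category.assoc, AbelianVariety.prodLift_fst, Preadditive.comp_sub, AbelianVariety.prodLift_fst,
        ← Category.assoc, AbelianVariety.prodLift_snd, Category.id_comp, add_sub_cancel_right]
    · rw [Category.assoc, AbelianVariety.prodLift_snd, AbelianVariety.prodLift_snd, Category.id_comp]
  have hτσ : τ ≫ σ = 𝟙 (A.prod B) := by
    apply AbelianVariety.prod_hom_ext
    · rw [Category.assoc, AbelianVariety.prodLift_fst, Preadditive.comp_add, AbelianVariety.prodLift_fst,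
        ← Category.assoc, AbelianVariety.prodLift_snd, Category.id_comp, sub_add_cancel]
    · rw [Category.assoc, AbelianVariety.prodLift_snd, AbelianVariety.prodLift_snd, Category.id_comp]
  haveI : IsIso σ.hom.hom.hom.left :=
    ⟨⟨τ.hom.hom.hom.left, by
      change (σ ≫ τ).hom.hom.hom.left = (𝟙 (A.prod B) : A.prod B ⟶ A.prod B).hom.hom.hom.left
      rw [hστ], by
      change (τ ≫ σ).hom.hom.hom.left = (𝟙 (A.prod B) : A.prod B ⟶ A.prod B).hom.hom.hom.left
      rw [hτσ]⟩⟩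
  haveI : AlgebraicGeometry.Flat (AbelianVariety.fst A B).hom.hom.hom.left :=
    inferInstanceAs (AlgebraicGeometry.Flat (Limits.pullback.fst A.X.hom B.X.hom))
  rw [show AbelianVariety.fst A B + AbelianVariety.snd A B ≫ g = σ ≫ AbelianVariety.fst A B by
    rw [AbelianVariety.prodLift_fst]]
  change AlgebraicGeometry.Flat (σ.hom.hom.hom.left ≫ (AbelianVariety.fst A B).hom.hom.hom.left)
  infer_instance

/-- `x ∪ x = 0` for a degree-one class (graded commutativity, characteristic `0`).
[cite: HatcherAT2002, §3.2 Thm. 3.11] -/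
private theorem cupProduct_self_deg_one {Y : Type} [TopologicalSpace Y] (x : singularCohomology ℂ ℂ Y 1) :
    cupProduct (show 1 + 1 = 2 from rfl) x x = 0 := by
  have h := cupProduct_gradedComm_holds ℂ Y (show 1 + 1 = 2 from rfl) (show 1 + 1 = 2 from rfl) x x
  rw [pow_one, neg_one_smul] at h
  have h2 : (2 : ℂ) • cupProduct (show 1 + 1 = 2 from rfl) x x = 0 := by
    rw [two_smul]
    nth_rewrite 2 [h]
    rw [add_neg_cancel]
  exact (smul_eq_zero.mp h2).resolve_left two_ne_zero

/-- `(fst^* a ∪ snd^* b) ∪ (fst^* c ∪ snd^* d) = -(fst^*(a ∪ c) ∪ snd^*(b ∪ d))` for degree-one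
classes (associativity, naturality, graded commutativity of `∪`). [cite: HatcherAT2002, §3.2 Prop. 3.10 and Thm. 3.11] -/
private theorem cross_cup_cross {A B : AbelianVariety ℂ} (a c : complexBetti A.X 1) (b d : complexBetti B.X 1) :
    cupProduct (show 2 + 2 = 4 from rfl)
      (cupProduct (show 1 + 1 = 2 from rfl) (complexBetti.map (AbelianVariety.fst A B).hom.hom.hom 1 a)
        (complexBetti.map (AbelianVariety.snd A B).hom.hom.hom 1 b))
      (cupProduct (show 1 + 1 = 2 from rfl) (complexBetti.map (AbelianVariety.fst A B).hom.hom.hom 1 c)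
        (complexBetti.map (AbelianVariety.snd A B).hom.hom.hom 1 d)) =
    -cupProduct (show 2 + 2 = 4 from rfl)
      (complexBetti.map (AbelianVariety.fst A B).hom.hom.hom 2 (cupProduct (show 1 + 1 = 2 from rfl) a c))
      (complexBetti.map (AbelianVariety.snd A B).hom.hom.hom 2 (cupProduct (show 1 + 1 = 2 from rfl) b d)) := by
  set F := complexBetti.map (AbelianVariety.fst A B).hom.hom.hom with hF
  set S := complexBetti.map (AbelianVariety.snd A B).hom.hom.hom with hS
  rw [cupProduct_assoc (show 1 + 1 = 2 from rfl) (show 1 + 2 = 3 from rfl) (show 2 + 2 = 4 from rfl)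
      (show 1 + 3 = 4 from rfl),
    ← cupProduct_assoc (show 1 + 1 = 2 from rfl) (show 1 + 1 = 2 from rfl) (show 2 + 1 = 3 from rfl)
      (show 1 + 2 = 3 from rfl) (S 1 b) (F 1 c) (S 1 d),
    cupProduct_gradedComm_holds ℂ _ (show 1 + 1 = 2 from rfl) (show 1 + 1 = 2 from rfl) (S 1 b) (F 1 c),
    pow_one, neg_one_smul, map_neg, LinearMap.neg_apply, map_neg,
    cupProduct_assoc (show 1 + 1 = 2 from rfl) (show 1 + 1 = 2 from rfl) (show 2 + 1 = 3 from rfl)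
      (show 1 + 2 = 3 from rfl) (F 1 c) (S 1 b) (S 1 d), hS, ← cupProduct_map,
    ← cupProduct_assoc (show 1 + 1 = 2 from rfl) (show 1 + 2 = 3 from rfl) (show 2 + 2 = 4 from rfl)
      (show 1 + 3 = 4 from rfl), hF, ← cupProduct_map]

/-! ## The registered sub-goal -/

/-- **Sub-goal G2b — the descent pair on the CM surface `(E × E, (ι, -ι))`.** For a complex abelian
variety `E` of dimension `1` with an endomorphism `ι`, `ι ≫ ι = -7`, and rational, `ℂ`-independent,
spanning classes `α, β ∈ H¹(E(ℂ); ℂ)` with `α ∪ β ≠ 0`: on `B = E × E` with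
`ψ = prodLift (fst ≫ ι) (snd ≫ (-ι))` there are `b₊ ∈ Eig((𝟙+ψ)^*, (1+i√7)²)`,
`b₋ ∈ Eig((𝟙+ψ)^*, (1-i√7)²)` in `H²(B(ℂ); ℂ)` with `b₊ + b₋` rational of Hodge type `(1,1)`, and an
algebraic `η ∈ N¹H²(B(ℂ); ℂ)` with `b₊ ⌣ η ≠ 0`, `b₋ ⌣ η ≠ 0` in `H⁴`. Witnesses (module docstring):
`b_± = fst^* x_± ∪ snd^* x_∓` for the `ι^*`-eigenclasses `x_± = ι^*α ± i√7·α`, and `η = b₊ + b₋`,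
which is `-2b · ((fst + snd ≫ ι)^*ω - fst^*ω - 7 snd^*ω)`, `ω = α ∪ β`, `b ≠ 0` the `β`-coordinate
of `ι^*α` — a combination of flat pull-backs of the algebraic top class of `E`, hence algebraic and
`(1,1)`; `b_± ⌣ η = (2 i√7 b)² fst^*ω ∪ snd^*ω ≠ 0` by Künneth. Schoen's "`W_{A'}` is generated by
classes of divisors" on van Geemen's CM surface. [cite: Schoen1998HodgeWeilAddendum, §10 (proof of the Proposition, p. 333)]
[cite: vanGeemen1994HodgeAV, 5.3 and Lemma 5.2 (6)] -/
theorem stub_cmDescentPair :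
    ∀ (E : AbelianVariety ℂ) (ι : E ⟶ E), E.dim = 1 → ι ≫ ι = -((7 : ℤ) • 𝟙 E) →
    ∀ (α β : complexBetti E.X 1), IsRationalClass α → IsRationalClass β →
      LinearIndependent ℂ ![α, β] → Submodule.span ℂ (Set.range ![α, β]) = ⊤ →
      cupProduct (rfl : 1 + 1 = 2) α β ≠ 0 →
      ∃ bp bm η : complexBetti (E.prod E).X 2,
        bp ∈ Module.End.eigenspace (complexBetti.map (𝟙 (E.prod E) +
              AbelianVariety.prodLift (AbelianVariety.fst E E ≫ ι) (AbelianVariety.snd E E ≫ (-ι))).hom.hom.hom 2).hom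
              ((1 + Complex.I * (Real.sqrt (7 : ℝ) : ℂ)) ^ 2) ∧
        bm ∈ Module.End.eigenspace (complexBetti.map (𝟙 (E.prod E) +
              AbelianVariety.prodLift (AbelianVariety.fst E E ≫ ι) (AbelianVariety.snd E E ≫ (-ι))).hom.hom.hom 2).hom
              ((1 - Complex.I * (Real.sqrt (7 : ℝ) : ℂ)) ^ 2) ∧
        IsRationalClass (bp + bm) ∧ IsOfHodgeType 2 (E.prod E).X 2 1 1 (bp + bm) ∧
        η ∈ algebraicClasses (E.prod E).X 1 ∧
        cupProduct (show 2 + 2 = 4 from rfl) bp η ≠ 0 ∧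
        cupProduct (show 2 + 2 = 4 from rfl) bm η ≠ 0 := by
  intro E ι hdim hι α β hα hβ hli hsp h0
  have hE : IsSmoothProjective 1 E.X := isSmoothProjective_of_dim_eq hdim
  have hB : IsSmoothProjective 2 (E.prod E).X :=
    isSmoothProjective_of_dim_eq (by rw [AbelianVariety.dim_prod, hdim])
  have h11 : 1 + 1 = 2 := rfl; have h22 : 2 + 2 = 4 := rfl
  -- `ψ = (ι, -ι)` lies over `ι` and `-ι`; `ν = i√7`
  set ψ : E.prod E ⟶ E.prod E :=
    AbelianVariety.prodLift (AbelianVariety.fst E E ≫ ι) (AbelianVariety.snd E E ≫ (-ι))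
  have h₁ : ψ ≫ AbelianVariety.fst E E = AbelianVariety.fst E E ≫ ι := AbelianVariety.prodLift_fst _ _
  have h₂ : ψ ≫ AbelianVariety.snd E E = AbelianVariety.snd E E ≫ (-ι) := AbelianVariety.prodLift_snd _ _
  set ν : ℂ := Complex.I * (Real.sqrt (7 : ℝ) : ℂ)
  have hν : ν * ν = -7 := by have h := I_mul_sqrt_mul_self 7; push_cast at h; exact h
  have hν0 : ν ≠ 0 := fun h ↦ by rw [h, mul_zero] at hν; norm_num at hν
  -- OPAQUE symbols for `fst^*`, `snd^*`, `ι^*`, `(fst + snd ≫ ι)^*` (module docstring, design note)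
  obtain ⟨F, hF⟩ : ∃ F : (k : ℕ) → (complexBetti E.X k ⟶ complexBetti (E.prod E).X k),
      F = fun k ↦ complexBetti.map (AbelianVariety.fst E E).hom.hom.hom k := ⟨_, rfl⟩
  obtain ⟨S, hS⟩ : ∃ S : (k : ℕ) → (complexBetti E.X k ⟶ complexBetti (E.prod E).X k),
      S = fun k ↦ complexBetti.map (AbelianVariety.snd E E).hom.hom.hom k := ⟨_, rfl⟩
  obtain ⟨J, hJ⟩ : ∃ J : (k : ℕ) → (complexBetti E.X k ⟶ complexBetti E.X k),
      J = fun k ↦ complexBetti.map ι.hom.hom.hom k := ⟨_, rfl⟩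
  obtain ⟨P, hP⟩ : ∃ P : (k : ℕ) → (complexBetti E.X k ⟶ complexBetti (E.prod E).X k), P = fun k ↦
      complexBetti.map (AbelianVariety.fst E E + AbelianVariety.snd E E ≫ ι).hom.hom.hom k := ⟨_, rfl⟩
  set ω : complexBetti E.X 2 := cupProduct h11 α β with hω
  have hJJ : ∀ v : complexBetti E.X 1, J 1 (J 1 v) = -(7 : ℂ) • v := fun v ↦ by
    simp only [hJ]; exact map_map_eq_neg_seven_smul hι v
  have hJrat : ∀ {v : complexBetti E.X 1}, IsRationalClass v → IsRationalClass (J 1 v) :=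
    fun hv ↦ by simp only [hJ]; exact hv.map _
  have hFrat : ∀ {k : ℕ} {v : complexBetti E.X k}, IsRationalClass v → IsRationalClass (F k v) :=
    fun hv ↦ by simp only [hF]; exact hv.map _
  have hSrat : ∀ {k : ℕ} {v : complexBetti E.X k}, IsRationalClass v → IsRationalClass (S k v) :=
    fun hv ↦ by simp only [hS]; exact hv.map _
  have hFF : cupProduct h11 (F 1 α) (F 1 β) = F 2 ω := by
    simp only [hF, hω]; exact (cupProduct_map _ h11 α β).symm
  have hSS : cupProduct h11 (S 1 α) (S 1 β) = S 2 ω := by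
    simp only [hS, hω]; exact (cupProduct_map _ h11 α β).symm
  have hPcup : P 2 ω = cupProduct h11 (P 1 α) (P 1 β) := by
    simp only [hP, hω]; exact cupProduct_map _ h11 α β
  have hPv : ∀ v : complexBetti E.X 1, P 1 v = F 1 v + S 1 (J 1 v) := fun v ↦ by
    simp only [hP, hF, hS, hJ]; rw [complexBetti_map_add_deg_one, ← complexBetti_map_map_hom]
  have hcross : ∀ u u' v v' : complexBetti E.X 1,
      cupProduct h22 (cupProduct h11 (F 1 u) (S 1 v)) (cupProduct h11 (F 1 u') (S 1 v')) =
        -cupProduct h22 (F 2 (cupProduct h11 u u')) (S 2 (cupProduct h11 v v')) := fun u u' v v' ↦ by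
    simp only [hF, hS]; exact cross_cup_cross u u' v v'
  have hFS : cupProduct h22 (F 2 ω) (S 2 ω) ≠ 0 := by
    simp only [hF, hS, hω]
    exact cupProduct_map_fst_map_snd_ne_zero (Y := E.X) (Z := E.X) hE hE (k := 4) (q := 2) (by norm_num)
      (by norm_num) h0 h0
  have hF0 : F 2 0 = 0 := (F 2).hom.map_zero
  have hS0 : S 2 0 = 0 := (S 2).hom.map_zero
  -- `ω ∈ N¹H²(E)` (top degree), pulled back along the FLAT maps `fst`, `snd`, `fst + snd ≫ ι`
  have hωalg : ω ∈ algebraicClasses E.X 1 := mem_algebraicClasses_of_degree_top hE le_rfl ω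
  have hFω : F 2 ω ∈ algebraicClasses (E.prod E).X 1 := by
    haveI : AlgebraicGeometry.Flat (AbelianVariety.fst E E).hom.hom.hom.left :=
      inferInstanceAs (AlgebraicGeometry.Flat (Limits.pullback.fst E.X.hom E.X.hom))
    simp only [hF]; exact map_mem_algebraicClasses_of_flat _ hωalg
  have hSω : S 2 ω ∈ algebraicClasses (E.prod E).X 1 := by
    haveI : AlgebraicGeometry.Flat (AbelianVariety.snd E E).hom.hom.hom.left :=
      inferInstanceAs (AlgebraicGeometry.Flat (Limits.pullback.snd E.X.hom E.X.hom))
    simp only [hS]; exact map_mem_algebraicClasses_of_flat _ hωalg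
  have hPω : P 2 ω ∈ algebraicClasses (E.prod E).X 1 := by
    haveI := flat_fst_add_snd_comp (A := E) (B := E) ι
    simp only [hP]; exact map_mem_algebraicClasses_of_flat _ hωalg
  -- coordinates of `ι^* α`, `ι^* β` in the rational basis `(α, β)`; `a ∈ ℚ`
  let bE : Module.Basis (Fin 2) ℂ (complexBetti E.X 1) := Module.Basis.mk hli hsp.ge
  have hbE : ∀ i, bE i = ![α, β] i := fun i ↦ Module.Basis.mk_apply hli _ i
  have hbE0 : bE 0 = α := by rw [hbE]; rfl
  have hbE1 : bE 1 = β := by rw [hbE]; rfl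
  have hbErat : ∀ i, IsRationalClass (bE i) :=
    Fin.forall_fin_two.2 ⟨by rw [hbE0]; exact hα, by rw [hbE1]; exact hβ⟩
  set a : ℂ := bE.repr (J 1 α) 0
  set b : ℂ := bE.repr (J 1 α) 1
  set c : ℂ := bE.repr (J 1 β) 0
  set d : ℂ := bE.repr (J 1 β) 1
  have hJα : J 1 α = a • α + b • β := by
    have h := bE.sum_repr (J 1 α); rw [Fin.sum_univ_two, hbE0, hbE1] at h; exact h.symm
  have hJβ : J 1 β = c • α + d • β := by
    have h := bE.sum_repr (J 1 β); rw [Fin.sum_univ_two, hbE0, hbE1] at h; exact h.symm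
  obtain ⟨q, hq'⟩ := repr_mem_range_ratCast_of_isRationalClass bE hbErat (hJrat hα) 0
  have hq : (q : ℂ) = a := hq'
  -- `a² + bc = -7`, `b(a + d) = 0` (from `J² α = -7 α`); hence `b ≠ 0`, `d = -a`
  have hrel : a * a + b * c + 7 = 0 ∧ a * b + b * d = 0 := by
    have h := hJJ α
    rw [hJα, map_add, map_smul, map_smul, hJα, hJβ] at h
    refine LinearIndependent.pair_iff.1 hli _ _ ?_
    calc (a * a + b * c + 7) • α + (a * b + b * d) • β
        = (a • (a • α + b • β) + b • (c • α + d • β)) - (-(7 : ℂ)) • α := by module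
      _ = 0 := by rw [h, sub_self]
  have hb0 : b ≠ 0 := by
    intro hb0
    have h : a * a = -7 := by linear_combination hrel.1 + (-c) * hb0
    rw [← hq] at h
    have h' : (q * q : ℚ) = -7 := by exact_mod_cast h
    have h0q : (0 : ℚ) ≤ q * q := mul_self_nonneg q
    rw [h'] at h0q
    norm_num at h0q
  have hda : d = -a := by
    have h : b * (a + d) = 0 := by linear_combination hrel.2
    linear_combination (mul_eq_zero.mp h).resolve_left hb0
  have hbc : b * c = -7 - a * a := by linear_combination hrel.1
  -- the `ι^*`-eigenclasses `x_± = ι^* α ± ν α` and the Weil components `b₊`, `b₋`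
  set xp : complexBetti E.X 1 := J 1 α + ν • α with hxp
  set xm : complexBetti E.X 1 := J 1 α + (-ν) • α with hxm
  have hJx : ∀ t : ℂ, t * t = -7 → J 1 (J 1 α + t • α) = t • (J 1 α + t • α) := fun t ht ↦ by
    rw [map_add, map_smul, hJJ, smul_add, smul_smul, ht]; module
  have hxpJ : complexBetti.map ι.hom.hom.hom 1 xp = ν • xp := by
    have h : J 1 xp = ν • xp := hJx ν hν
    simpa only [hJ] using h
  have hxmJ : complexBetti.map ι.hom.hom.hom 1 xm = (-ν) • xm := by
    have h : J 1 xm = (-ν) • xm := hJx (-ν) (by rw [neg_mul_neg, hν])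
    simpa only [hJ] using h
  set bp : complexBetti (E.prod E).X 2 := cupProduct h11 (F 1 xp) (S 1 xm) with hbp
  set bm : complexBetti (E.prod E).X 2 := cupProduct h11 (F 1 xm) (S 1 xp) with hbm
  have hbpT : complexBetti.map (𝟙 (E.prod E) + ψ).hom.hom.hom 2 bp = ((1 + ν) * (1 - -ν)) • bp := by
    simp only [hbp, hF, hS]
    exact map_one_add_cupProduct_fst_snd h11 h₁ h₂ (map_one_add_of_eigen ι hxpJ)
      (map_one_add_neg_of_eigen ι hxmJ)
  have hbmT : complexBetti.map (𝟙 (E.prod E) + ψ).hom.hom.hom 2 bm = ((1 + -ν) * (1 - ν)) • bm := by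
    simp only [hbm, hF, hS]
    exact map_one_add_cupProduct_fst_snd h11 h₁ h₂ (map_one_add_of_eigen ι hxmJ)
      (map_one_add_neg_of_eigen ι hxpJ)
  -- `b₊ + b₋ = 2 FJα ∪ SJα + 14 Fα ∪ Sα` is rational
  have hsum : bp + bm = (2 : ℂ) • cupProduct h11 (F 1 (J 1 α)) (S 1 (J 1 α)) +
      (14 : ℂ) • cupProduct h11 (F 1 α) (S 1 α) := by
    rw [hbp, hbm, hxp, hxm]
    simp only [map_add, map_smul, LinearMap.add_apply, LinearMap.smul_apply, smul_add, smul_smul]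
    match_scalars <;> first | ring1 | linear_combination (-2 : ℂ) * hν
  have hrat : IsRationalClass (bp + bm) := by
    rw [hsum, show (2 : ℂ) = ((2 : ℚ) : ℂ) by norm_num, show (14 : ℂ) = ((14 : ℚ) : ℂ) by norm_num]
    exact (((hFrat (hJrat hα)).cup h11 (hSrat (hJrat hα))).smul 2).add
      (((hFrat hα).cup h11 (hSrat hα)).smul 14)
  -- the frame `Fu ∪ Sv`, `u, v ∈ {α, β}`: `FJα ∪ SJα` and `(fst + snd ≫ ι)^* ω` expanded
  have hSβα : cupProduct h11 (S 1 β) (S 1 α) = -S 2 ω := by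
    rw [cupProduct_gradedComm_holds ℂ _ h11 h11 (S 1 β) (S 1 α), hSS, pow_one, neg_one_smul]
  have hSαFβ : cupProduct h11 (S 1 α) (F 1 β) = -cupProduct h11 (F 1 β) (S 1 α) := by
    rw [cupProduct_gradedComm_holds ℂ _ h11 h11 (S 1 α) (F 1 β), pow_one, neg_one_smul]
  have hSβFβ : cupProduct h11 (S 1 β) (F 1 β) = -cupProduct h11 (F 1 β) (S 1 β) := by
    rw [cupProduct_gradedComm_holds ℂ _ h11 h11 (S 1 β) (F 1 β), pow_one, neg_one_smul]
  have hT1 : cupProduct h11 (F 1 (J 1 α)) (S 1 (J 1 α)) =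
      (a * a) • cupProduct h11 (F 1 α) (S 1 α) + (a * b) • cupProduct h11 (F 1 α) (S 1 β) +
        (a * b) • cupProduct h11 (F 1 β) (S 1 α) + (b * b) • cupProduct h11 (F 1 β) (S 1 β) := by
    rw [hJα]
    simp only [map_add, map_smul, LinearMap.add_apply, LinearMap.smul_apply, smul_add, smul_smul]
    module
  have hsω : P 2 ω = F 2 ω + (a * d - b * c) • S 2 ω +
      (c • cupProduct h11 (F 1 α) (S 1 α) + d • cupProduct h11 (F 1 α) (S 1 β) -
        a • cupProduct h11 (F 1 β) (S 1 α) - b • cupProduct h11 (F 1 β) (S 1 β)) := by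
    rw [hPcup, hPv, hPv, hJα, hJβ]
    simp only [map_add, map_smul, LinearMap.add_apply, LinearMap.smul_apply, smul_add, smul_smul,
      hFF, hSS, cupProduct_self_deg_one, hSβα, hSαFβ, hSβFβ, smul_zero, add_zero, smul_neg]
    module
  -- `b₊ + b₋ = -2b · D`, `D = (fst + snd ≫ ι)^*ω - Fω - 7 Sω` algebraic; hence of type `(1,1)`
  set D : complexBetti (E.prod E).X 2 := P 2 ω - F 2 ω - (7 : ℂ) • S 2 ω with hD
  have hsumD : bp + bm = (-2 * b) • D := by
    rw [hsum, hT1, hD, hsω, hda]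
    match_scalars <;>
      first | ring1 | linear_combination (2 : ℂ) * hbc | linear_combination (-2 * b) * hbc
  have halg : bp + bm ∈ algebraicClasses (E.prod E).X 1 := by
    rw [hsumD]
    exact Submodule.smul_mem _ _
      (Submodule.sub_mem _ (Submodule.sub_mem _ hPω hFω) (Submodule.smul_mem _ _ hSω))
  -- `b₊ ∪ b₋ = b₋ ∪ b₊ = (2νb)² Fω ∪ Sω ≠ 0` (`x₊ ∪ x₋ = 2νb ω`), `b₊ ∪ b₊ = b₋ ∪ b₋ = 0`
  have hαJα : cupProduct h11 α (J 1 α) = b • ω := by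
    rw [hJα, map_add, map_smul, map_smul, cupProduct_self_deg_one, smul_zero, zero_add]
  have hJαα : cupProduct h11 (J 1 α) α = -(b • ω) := by
    rw [cupProduct_gradedComm_holds ℂ _ h11 h11 (J 1 α) α, hαJα, pow_one, neg_one_smul]
  have hpm : cupProduct h11 xp xm = (2 * ν * b) • ω := by
    rw [hxp, hxm]
    simp only [map_add, map_smul, LinearMap.add_apply, LinearMap.smul_apply, smul_smul,
      cupProduct_self_deg_one, hαJα, hJαα, smul_zero, smul_neg, zero_add, add_zero]
    module
  have hmp : cupProduct h11 xm xp = -((2 * ν * b) • ω) := by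
    rw [cupProduct_gradedComm_holds ℂ _ h11 h11 xm xp, hpm, pow_one, neg_one_smul]
  have hcoef : (2 * ν * b) * (2 * ν * b) ≠ 0 :=
    mul_self_ne_zero.2 (mul_ne_zero (mul_ne_zero two_ne_zero hν0) hb0)
  have hbpbm : cupProduct h22 bp bm = ((2 * ν * b) * (2 * ν * b)) • cupProduct h22 (F 2 ω) (S 2 ω) := by
    rw [hbp, hbm, hcross, hpm, hmp]
    simp only [map_smul, map_neg, LinearMap.smul_apply, neg_neg, smul_smul]
  have hbmbp : cupProduct h22 bm bp = ((2 * ν * b) * (2 * ν * b)) • cupProduct h22 (F 2 ω) (S 2 ω) := by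
    rw [hbp, hbm, hcross, hpm, hmp]
    simp only [map_smul, map_neg, LinearMap.smul_apply, LinearMap.neg_apply, smul_neg, neg_neg, smul_smul]
  have hbpbp : cupProduct h22 bp bp = 0 := by
    rw [hbp, hcross, cupProduct_self_deg_one, cupProduct_self_deg_one, hF0, hS0, map_zero, neg_zero]
  have hbmbm : cupProduct h22 bm bm = 0 := by
    rw [hbm, hcross, cupProduct_self_deg_one, cupProduct_self_deg_one, hF0, hS0, map_zero, neg_zero]
  refine ⟨bp, bm, bp + bm, ?_, ?_, hrat, isOfHodgeType_oneOne_of_mem_algebraicClasses_surface hB halg,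
    halg, ?_, ?_⟩
  · -- `b₊ ∈ Eig((𝟙+ψ)^*, (1 + i√7)²)`
    rw [Module.End.mem_eigenspace_iff, show (1 + ν) ^ 2 = (1 + ν) * (1 - -ν) by ring]
    exact hbpT
  · -- `b₋ ∈ Eig((𝟙+ψ)^*, (1 - i√7)²)`
    rw [Module.End.mem_eigenspace_iff, show (1 - ν) ^ 2 = (1 + -ν) * (1 - ν) by ring]
    exact hbmT
  · -- `b₊ ∪ η ≠ 0`
    rw [map_add, hbpbp, hbpbm, zero_add]
    exact smul_ne_zero hcoef hFS
  · -- `b₋ ∪ η ≠ 0`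
    rw [map_add, hbmbp, hbmbm, add_zero]
    exact smul_ne_zero hcoef hFS

end Summit.HodgeConjecture.HodgeConjecture.Theorems.WeilSixfoldsSqrtMinus7.HyperbolicEightfoldDescent

end
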